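import Summits.Ventures.Crystal3D.Theorems.StickyWulffConstantTextureLiminfTexShadowFluxPairSteerCore
import Summits.Ventures.Crystal3D.Theorems.StickyWulffConstantTextureLiminfTexShadowSteepPlateTwin
import Summits.Ventures.Crystal3D.Theorems.StickyWulffConstantTextureLiminfTexShadowCoverageBarlowSteer2WideRepDefs
import HarnessLib

/-!
# TexShadow row (e) / EDGE-ON flux class: every plate launches ONE steered family whose ADJACENT-MEAN strength is `≥ √3/4`
# (lane T, crux `TextureLiminfV5`, stmt-Ventures-23912, sub-crux EDGE-ON; cf-p1 (cxcvi); 19480-p2 ALPHA-OBJECTION; memo HOME/wall-p1-g16/ALPHA-ANSWER.md §3)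

HONEST FRAMING. Venture `Summits/Ventures/Crystal3D` (cell `crystal3d-full`), route `route-Ventures-StickyWulffConstant`, helper
`--supports` the law-v5 crux `TextureLiminfV5` (stmt-Ventures-23912).  Sphere geometry of the reference slots only; standard axioms; NO
certificate, NO walker statement, NO wall law is proved; rung F-C1 not moved.

CONTEXT.  The k = 4 «same-base additivity» (α) behind the two-steering closure of the flux-pair sliver is FALSE (19480-p2 g12, HOME/wall-p2-g12/
ALPHA-OBJECTION.md; conceded in HOME/wall-p1-g16/ALPHA-ANSWER.md): a second steering of the same slot re-merges with the first after every ∇→Δ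
step, so with the PER-BILAYER-PAIR flux clause `√2·c₀ ≤ r₁ i + r₂ j` no walker scheme beats the single best capper `1/(2√3)` on a ∇-bilayer.  The
surviving candidate is an ADJACENT-MEAN flux count on the T-side (`Σ_i √2·½(r_i + r_{i+1})·vol_i ≤ #T + O(ρ/sin β)`), for which the per-plate input
is ONE steered family (the represented menu of record, p709650/p712363) whose slot rise `s` and capper rise `c` satisfy `½(s + c) ≥ √3/4` and
`s ≥ 1/2`: then `(Δ,∇)`/`(∇,Δ)` junctions certify `√3/4`, `(Δ,Δ)` junctions `≥ 1/2`, and two plates give `≥ √3/2 > √2·13/25` (the `(∇,∇)` junctions —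
c-layers — are the row family's, not claimed here).  THIS FILE proves the geometric input:
* `fluxMean_core` — in the coordinates `(pk, Q, H)` of the best of the six directions (`3pk² + Q² + (3/2)H² = 1`, `0 ≤ Q ≤ pk`, `H ≥ 0`):
  `H + ¾pk + ¼Q ≥ √3/4` (the mean of slot and near capper) and `H + ½pk + ½Q ≥ √3/6 ≥ 1/4` (the near capper: the typed floor holds);
* `bestCapper_eq_neg_minimiser` — the `Gζ`-best ∇-capper of the basal twin of `G` is `−u` for a reference up-slot `u` minimising `⟪M ·, ζ⟫`;
* `exists_launch_mean_of_rises` (frame level) and **`exists_rep_steerLaunch_mean`** (plate level, given or twin presentation): a launch `(z, v)`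
  satisfying `SteerLaunchAt (1/3) F σ e z v` for EVERY word (p706442's predicate, floor `1/4` met), slot rise `≥ 1/2`, and
  `½(⟪upFrame F e v, e⟫ + capper rise) ≥ √3/4`; corollary `steerRise_adjMean_ge`: on every pair of consecutive bilayers not both ∇,
  `½(steerRise i + steerRise (i+1)) ≥ √3/4`; arithmetic `sqrt_two_mul_c0_le_sqrt_three_div_two`.
WHAT THIS IS NOT: not the T-side adjacent-mean glue, not the row credit on c-layers, no certificate; F-C1 not moved.
-/

noncomputable section

open scoped BigOperators InnerProductSpace

namespace Summit.Ventures.Crystal3D.Cruxes.TextureLiminf.TexShadow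

open Summit.Ventures.Crystal3D Summit.Ventures.Crystal3D.Theorems
open Literature.MathematicalPhysics.StatisticalMechanics (basalMirror basalMirror_apply_coord)

/-! ## The real core: the mean of slot and near capper -/

/-- **Adjacent-mean core.**  `3pk² + Q² + (3/2)H² = 1`, `0 ≤ Q ≤ pk`, `0 ≤ H` (the best-of-six coordinates of a unit model axis) ⇒ the mean of
the slot rise `H + pk` and the near capper rise `H + pk/2 + Q/2` is `≥ √3/4`, and the near capper rise is `≥ √3/6` (`= 1/(2√3)`, so `≥ 1/4`).
Equality at `H = Q = 0`, `pk = 1/√3` (wall normal on the equator along the slot's azimuth). -/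
theorem fluxMean_core (pk Q H : ℝ) (hH : 0 ≤ H) (hQ0 : 0 ≤ Q) (hQ : Q ≤ pk) (hsph : 3 * pk ^ 2 + Q ^ 2 + 3 / 2 * H ^ 2 = 1) :
    Real.sqrt 3 / 4 ≤ (H + pk + (H + pk / 2 + Q / 2)) / 2 ∧ Real.sqrt 3 / 6 ≤ H + pk / 2 + Q / 2 := by
  set s : ℝ := Real.sqrt 3 with hs
  have hs2 : s ^ 2 = 3 := Real.sq_sqrt (by norm_num)
  have hs0 : 0 < s := Real.sqrt_pos.2 (by norm_num)
  have hpk0 : 0 ≤ pk := hQ0.trans hQ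
  -- s·pk ≤ 1, s·H ≤ 3/2, s·Q ≤ 1 (from the sphere relation)
  have hspk : s * pk ≤ 1 := by nlinarith [mul_nonneg hs0.le hpk0]
  have hsH : s * H ≤ 3 / 2 := by nlinarith [mul_nonneg hs0.le hH]
  have hsQ : s * Q ≤ 1 := by nlinarith [mul_nonneg hs0.le hQ0]
  -- pk ≥ s·pk²
  have hpk2 : s * pk ^ 2 ≤ pk := by nlinarith [mul_nonneg hs0.le hpk0]
  -- s·(3pk²) = s·(1 − Q² − 3/2 H²)
  have hkey : s / 4 * (3 * pk ^ 2) = s / 4 - s / 4 * Q ^ 2 - 3 * s / 8 * H ^ 2 := by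
    have : 3 * pk ^ 2 = 1 - Q ^ 2 - 3 / 2 * H ^ 2 := by linarith
    rw [this]; ring
  have hHterm : 0 ≤ H * (1 - 3 * s / 8 * H) := mul_nonneg hH (by nlinarith)
  have hQterm : 0 ≤ Q * (1 / 4 - s / 4 * Q) := mul_nonneg hQ0 (by nlinarith)
  have hQterm' : 0 ≤ Q * (1 / 2 - s / 6 * Q) := mul_nonneg hQ0 (by nlinarith)
  have hHterm' : 0 ≤ H * (1 - s / 4 * H) := mul_nonneg hH (by nlinarith)
  constructor
  · -- ¾pk ≥ (3s/4)pk² = (s/4)(3pk²)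
    nlinarith
  · -- ½pk ≥ (s/2)pk² = (s/6)(3pk²)
    nlinarith

/-- `√2·(13/25) ≤ √3/2`: two plates of adjacent-mean strength `√3/4` each meet the law-v5 flux charge `c₀ = 13/25`. -/
theorem sqrt_two_mul_c0_le_sqrt_three_div_two : Real.sqrt 2 * (13 / 25) ≤ Real.sqrt 3 / 4 + Real.sqrt 3 / 4 := by
  have h2 : Real.sqrt 2 * (13 / 25) = Real.sqrt (2 * (13 / 25) ^ 2) := by
    rw [Real.sqrt_mul (by norm_num), Real.sqrt_sq (by norm_num)]
  have h3 : Real.sqrt 3 / 4 + Real.sqrt 3 / 4 = Real.sqrt (3 / 4) := by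
    rw [Real.sqrt_div' _ (by norm_num : (0:ℝ) ≤ 4), show Real.sqrt 4 = 2 by
      rw [show (4:ℝ) = 2 ^ 2 by norm_num, Real.sqrt_sq (by norm_num)]]
    ring
  rw [h2, h3]
  exact Real.sqrt_le_sqrt (by norm_num)

/-- `√3/6 ≥ 1/4` (the typed ∇-capper floor is below the geometric one). -/
theorem quarter_le_sqrt_three_div_six : (1 / 4 : ℝ) ≤ Real.sqrt 3 / 6 := by
  have : (1.5 : ℝ) ≤ Real.sqrt 3 := by
    rw [show (1.5 : ℝ) = Real.sqrt (1.5 ^ 2) by rw [Real.sqrt_sq (by norm_num)]]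
    exact Real.sqrt_le_sqrt (by norm_num)
  linarith

/-! ## The `z`-best capper in the model -/

/-- **The best capper is the negative of a minimising up-slot.**  For a frame `G` and a model steering `ζ`, the `Gζ`-best ∇-capper `q` of
the basal twin of `G` is `−u` for a reference up-slot `u` minimising `⟪M ·, ζ⟫` over the three reference up-slots. -/
theorem bestCapper_eq_neg_minimiser (G : E3 ≃ₗᵢ[ℝ] E3) (ζ : E3) :
    ∃ u : E3, (u = upSlot₁ ∨ u = upSlot₂ ∨ u = upSlot₃) ∧ bestCapper (twinFrame G (G e₃)) (G e₃) (G ζ) = -u ∧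
      ∀ w : E3, (w = upSlot₁ ∨ w = upSlot₂ ∨ w = upSlot₃) → ⟪basalMirror u, ζ⟫_ℝ ≤ ⟪basalMirror w, ζ⟫_ℝ := by
  have he3 : (e₃ : E3) = EuclideanSpace.single (2 : Fin 3) (1 : ℝ) := rfl
  obtain ⟨hqS, hq2⟩ := bestCapper_nabla_slot G (G ζ)
  rw [← he3] at hqS hq2
  set q := bestCapper (twinFrame G (G e₃)) (G e₃) (G ζ) with hqdef
  have hGe : ∀ x : E3, ⟪twinFrame G (G e₃) x, G ζ⟫_ℝ = ⟪basalMirror x, ζ⟫_ℝ := by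
    intro x; rw [he3, twinFrame_axis_apply, LinearIsometryEquiv.inner_map_map]
  have hrpos : 0 < Real.sqrt (2 / 3) := Real.sqrt_pos.2 (by norm_num)
  have hpos_of_up : ∀ w ∈ fccSlots, w 2 = Real.sqrt (2 / 3) →
      -w ∈ fccSlots.filter (fun q' => 0 < ⟪twinFrame G (G e₃) q', G e₃⟫_ℝ) := by
    intro w hw hw2
    refine Finset.mem_filter.2 ⟨neg_mem_fccSlots hw, ?_⟩
    rw [he3, twinFrame_axis_apply, inner_frame_axis, basalMirror_apply_coord]
    simp only [if_true, PiLp.neg_apply, neg_neg, hw2]; exact hrpos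
  have hne : (fccSlots.filter fun q' => 0 < ⟪twinFrame G (G e₃) q', G e₃⟫_ℝ).Nonempty :=
    ⟨-upSlot₁, hpos_of_up _ upSlots_mem_fccSlots.1 upSlot₁_coord.2.2⟩
  obtain ⟨-, hmax⟩ := bestCapper_spec (twinFrame G (G e₃)) (G e₃) (G ζ) hne
  have hu : -q = upSlot₁ ∨ -q = upSlot₂ ∨ -q = upSlot₃ :=
    eq_upSlot_of_apply_two (neg_mem_fccSlots hqS) (by simp [hq2])
  refine ⟨-q, hu, (neg_neg q).symm, fun w hw => ?_⟩
  obtain ⟨h1, h2, h3⟩ := upSlots_mem_fccSlots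
  have hwS : w ∈ fccSlots ∧ w 2 = Real.sqrt (2 / 3) := by
    rcases hw with rfl | rfl | rfl
    · exact ⟨h1, upSlot₁_coord.2.2⟩
    · exact ⟨h2, upSlot₂_coord.2.2⟩
    · exact ⟨h3, upSlot₃_coord.2.2⟩
  have hm := hmax (-w) (hpos_of_up w hwS.1 hwS.2)
  rw [hGe, hGe, ← hqdef, map_neg, inner_neg_left] at hm
  rw [map_neg, inner_neg_left]; linarith

/-! ## The frame-level launch with adjacent-mean strength -/

/-- **ONE STEERING with adjacent-mean strength `≥ √3/4`, frame level.**  `G` a frame whose pulled-back unit axis lies in the closed upper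
half-space, `v` a reference up-slot (the two others `wa ≠ wb`) rising by `≥ 1/2` along `e` and out-rising both adjacent cappers.  Then the arc
steering of `exists_model_steering` gives a launch `(z, v)` at chord `1/3` (unit `z`, `‖z − e‖ ≤ 1/3`, `v` steep for `z`) whose `z`-best ∇-capper
rises by `≥ √3/6 ≥ 1/4`, and `½(slot rise + capper rise) ≥ √3/4`. -/
theorem exists_launch_mean_of_rises (G : E3 ≃ₗᵢ[ℝ] E3) {e : E3} (he : ‖e‖ = 1) (hG : 0 ≤ (G.symm e) 2) {v wa wb : E3}
    (hv : v = upSlot₁ ∨ v = upSlot₂ ∨ v = upSlot₃) (hwa : wa = upSlot₁ ∨ wa = upSlot₂ ∨ wa = upSlot₃)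
    (hwb : wb = upSlot₁ ∨ wb = upSlot₂ ∨ wb = upSlot₃) (hav : wa ≠ v) (hbv : wb ≠ v) (hab : wa ≠ wb)
    (hhalf : 1 / 2 ≤ ⟪G v, e⟫_ℝ) (hka : -⟪G (basalMirror wa), e⟫_ℝ ≤ ⟪G v, e⟫_ℝ)
    (hkb : -⟪G (basalMirror wb), e⟫_ℝ ≤ ⟪G v, e⟫_ℝ) :
    ∃ z : E3, ‖z‖ = 1 ∧ ‖z - e‖ ≤ 1 / 3 ∧ Real.sqrt 2 / 2 ≤ ⟪G v, z⟫_ℝ ∧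
      Real.sqrt 3 / 6 ≤ ⟪G (basalMirror (bestCapper (twinFrame G (G e₃)) (G e₃) z)), e⟫_ℝ ∧
      Real.sqrt 3 / 4 ≤ (⟪G v, e⟫_ℝ + ⟪G (basalMirror (bestCapper (twinFrame G (G e₃)) (G e₃) z)), e⟫_ℝ) / 2 := by
  -- WLOG the capper of `wa` is the NEAR one
  wlog hba : -⟪G (basalMirror wb), e⟫_ℝ ≤ -⟪G (basalMirror wa), e⟫_ℝ generalizing wa wb
  · exact this hwb hwa hbv hav (Ne.symm hab) hkb hka (le_of_not_ge hba)
  set ν : E3 := G.symm e with hνdef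
  have hνn : ‖ν‖ = 1 := by rw [hνdef, LinearIsometryEquiv.norm_map, he]
  have hGe : ∀ x : E3, ⟪G x, e⟫_ℝ = ⟪x, ν⟫_ℝ := fun x => inner_map_eq_inner_symm G x e
  simp only [hGe] at hhalf hka hkb hba ⊢
  have hvn : ‖v‖ = 1 := norm_upSlot_eq_one hv
  set A : ℝ := ⟪v, ν⟫_ℝ with hA
  set H : ℝ := Real.sqrt (2 / 3) * ν 2 with hH
  have hH0 : 0 ≤ H := mul_nonneg (Real.sqrt_nonneg _) hG
  have hRa : -⟪basalMirror wa, ν⟫_ℝ = 2 * H - ⟪wa, ν⟫_ℝ := capperRise_eq hwa ν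
  have hRb : -⟪basalMirror wb, ν⟫_ℝ = 2 * H - ⟪wb, ν⟫_ℝ := capperRise_eq hwb ν
  obtain ⟨hsum, hsph⟩ := slot_rises_perm hv hwa hwb hav hbv hab ν hνn
  have hsph' : 3 * (A - H) ^ 2 + (⟪wb, ν⟫_ℝ - ⟪wa, ν⟫_ℝ) ^ 2 + 3 / 2 * H ^ 2 = 1 := by
    have e1 : ⟪wa, ν⟫_ℝ + ⟪wb, ν⟫_ℝ - 2 * H = H - A := by linarith
    linear_combination hsph - (⟪wa, ν⟫_ℝ + ⟪wb, ν⟫_ℝ - 2 * H + (H - A)) * e1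
  obtain ⟨hmean, hfloor⟩ := fluxMean_core (A - H) (⟪wb, ν⟫_ℝ - ⟪wa, ν⟫_ℝ) H hH0 (by linarith) (by linarith) hsph'
  -- the arc steering and its best capper
  have ht : steerSteepCos (1 / 3) ≤ A := steerSteepCos_third_lt_half.le.trans hhalf
  have ht0 : 0 ≤ steerSteepCos (1 / 3) := (by norm_num : (0:ℝ) ≤ 1 / 4).trans steerSteepCos_third_ge_quarter
  obtain ⟨ζ, α, β, hα, hβ, hζ, hζn, hζν, hζv⟩ := exists_model_steering v ν (1 / 3) A hvn hνn rfl (by norm_num) (by norm_num) ht ht0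
  obtain ⟨u, hu, hcap, hmin⟩ := bestCapper_eq_neg_minimiser G ζ
  have hrise : -⟪basalMirror wa, ν⟫_ℝ ≤ ⟪basalMirror (bestCapper (twinFrame G (G e₃)) (G e₃) (G ζ)), ν⟫_ℝ := by
    rw [hcap, map_neg, inner_neg_left]
    exact capperRise_ge_of_minimiser hv hα hβ hζ hu hmin hwa hav
  refine ⟨G ζ, by rw [LinearIsometryEquiv.norm_map, hζn], ?_, by rw [LinearIsometryEquiv.inner_map_map]; exact hζv, ?_, ?_⟩
  · have : G ζ - e = G (ζ - ν) := by rw [map_sub, hνdef, LinearIsometryEquiv.apply_symm_apply]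
    rw [this, LinearIsometryEquiv.norm_map]; exact hζν
  · linarith
  · linarith

/-! ## The plate-level theorem: given or twin presentation -/

/-- **Rises of the twin re-presentation** (from `upFrame_twinRepFrame_apply`, p709650): the reference up-slot `v` of `upFrame (twinRepFrame L) e`
rises like `L`'s capper direction `−M v`, and its capper direction `−M w` rises like `L`'s slot `w`. -/
theorem twinRep_rises (L : E3 ≃ₗᵢ[ℝ] E3) (e v w : E3) :
    ⟪upFrame (twinRepFrame L) e v, e⟫_ℝ = -⟪upFrame L e (basalMirror v), e⟫_ℝ ∧
      -⟪upFrame (twinRepFrame L) e (basalMirror w), e⟫_ℝ = ⟪upFrame L e w, e⟫_ℝ := by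
  constructor
  · rw [upFrame_twinRepFrame_apply, inner_neg_left]
  · rw [upFrame_twinRepFrame_apply, inner_neg_left, neg_neg, Literature.MathematicalPhysics.StatisticalMechanics.basalMirror_basalMirror]

/-- **EVERY PLATE LAUNCHES ONE STEERED FAMILY OF ADJACENT-MEAN STRENGTH `≥ √3/4`.**  For every frame `L` and unit axis `e` there are a
presentation `F ∈ {L, twinRepFrame L}`, a reference up-slot `v` and a steering `z` with: `SteerLaunchAt (1/3) F σ e z v` for EVERY word `σ`
(p706442: unit `z` within chord `1/3` of `e`, `v` steep for `z`, ∇-capper floor `1/4` — here `≥ √3/6`), slot rise `⟪upFrame F e v, e⟫ ≥ 1/2`, and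
`½(slot rise + rise of the z-best ∇-capper) ≥ √3/4` (the term of `steerRise`, p705084).  PROOF: best of the six directions (`≥ 1/2`,
`exists_slot_or_capper_inner_ge_half`), then `exists_launch_mean_of_rises` in the given or the twin presentation. -/
theorem exists_rep_steerLaunch_mean (L : E3 ≃ₗᵢ[ℝ] E3) {e : E3} (he : ‖e‖ = 1) :
    ∃ F : E3 ≃ₗᵢ[ℝ] E3, (F = L ∨ F = twinRepFrame L) ∧ ∃ v z : E3,
      (v = upSlot₁ ∨ v = upSlot₂ ∨ v = upSlot₃) ∧ (∀ σ : ℤ → ℤ, SteerLaunchAt (1 / 3) F σ e z v) ∧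
      1 / 2 ≤ ⟪upFrame F e v, e⟫_ℝ ∧
      Real.sqrt 3 / 6 ≤ ⟪upFrame F e (basalMirror (bestCapper (twinFrame (upFrame F e) (upFrame F e e₃)) (upFrame F e e₃) z)), e⟫_ℝ ∧
      Real.sqrt 3 / 4 ≤ (⟪upFrame F e v, e⟫_ℝ +
        ⟪upFrame F e (basalMirror (bestCapper (twinFrame (upFrame F e) (upFrame F e e₃)) (upFrame F e e₃) z)), e⟫_ℝ) / 2 := by
  set G₀ := upFrame L e with hG₀
  set ν : E3 := G₀.symm e with hνdef
  have hνn : ‖ν‖ = 1 := by rw [hνdef, LinearIsometryEquiv.norm_map, he]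
  have hν2 : 0 ≤ ν 2 := upFrame_axis_nonneg L e
  have hGe : ∀ x : E3, ⟪G₀ x, e⟫_ℝ = ⟪x, ν⟫_ℝ := fun x => inner_map_eq_inner_symm G₀ x e
  obtain ⟨n12, n13, n23⟩ := upSlots_ne
  have hu1 : upSlot₁ = upSlot₁ ∨ upSlot₁ = upSlot₂ ∨ upSlot₁ = upSlot₃ := Or.inl rfl
  have hu2 : upSlot₂ = upSlot₁ ∨ upSlot₂ = upSlot₂ ∨ upSlot₂ = upSlot₃ := Or.inr (Or.inl rfl)
  have hu3 : upSlot₃ = upSlot₁ ∨ upSlot₃ = upSlot₂ ∨ upSlot₃ = upSlot₃ := Or.inr (Or.inr rfl)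
  obtain ⟨s1, s2, s3⟩ := upSlots_mem_fccSlots
  -- packaging: from the frame-level data to `SteerLaunchAt` and the conclusion
  have pack : ∀ (F : E3 ≃ₗᵢ[ℝ] E3) (v : E3), (F = L ∨ F = twinRepFrame L) → (v = upSlot₁ ∨ v = upSlot₂ ∨ v = upSlot₃) →
      1 / 2 ≤ ⟪upFrame F e v, e⟫_ℝ →
      (∃ z : E3, ‖z‖ = 1 ∧ ‖z - e‖ ≤ 1 / 3 ∧ Real.sqrt 2 / 2 ≤ ⟪upFrame F e v, z⟫_ℝ ∧
        Real.sqrt 3 / 6 ≤ ⟪upFrame F e (basalMirror (bestCapper (twinFrame (upFrame F e) (upFrame F e e₃)) (upFrame F e e₃) z)), e⟫_ℝ ∧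
        Real.sqrt 3 / 4 ≤ (⟪upFrame F e v, e⟫_ℝ +
          ⟪upFrame F e (basalMirror (bestCapper (twinFrame (upFrame F e) (upFrame F e e₃)) (upFrame F e e₃) z)), e⟫_ℝ) / 2) →
      ∃ F : E3 ≃ₗᵢ[ℝ] E3, (F = L ∨ F = twinRepFrame L) ∧ ∃ v z : E3,
        (v = upSlot₁ ∨ v = upSlot₂ ∨ v = upSlot₃) ∧ (∀ σ : ℤ → ℤ, SteerLaunchAt (1 / 3) F σ e z v) ∧
        1 / 2 ≤ ⟪upFrame F e v, e⟫_ℝ ∧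
        Real.sqrt 3 / 6 ≤ ⟪upFrame F e (basalMirror (bestCapper (twinFrame (upFrame F e) (upFrame F e e₃)) (upFrame F e e₃) z)), e⟫_ℝ ∧
        Real.sqrt 3 / 4 ≤ (⟪upFrame F e v, e⟫_ℝ +
          ⟪upFrame F e (basalMirror (bestCapper (twinFrame (upFrame F e) (upFrame F e e₃)) (upFrame F e e₃) z)), e⟫_ℝ) / 2 := by
    intro F v hF hv hhalf ⟨z, hz, hze, hsteep, hfloor, hmean⟩
    have hvS : v ∈ fccSlots ∧ v 2 = Real.sqrt (2 / 3) := by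
      rcases hv with rfl | rfl | rfl
      · exact ⟨s1, upSlot₁_coord.2.2⟩
      · exact ⟨s2, upSlot₂_coord.2.2⟩
      · exact ⟨s3, upSlot₃_coord.2.2⟩
    have hq := quarter_le_sqrt_three_div_six
    exact ⟨F, hF, v, z, hv, fun σ => ⟨hz, hze, hvS.1, hvS.2, hsteep, fun i _ => by linarith⟩, hhalf, hfloor, hmean⟩
  -- the best of the six rises (three slots, three cappers)
  obtain ⟨m, hmem, hmax⟩ := Finset.exists_max_image
    ({⟪G₀ upSlot₁, e⟫_ℝ, ⟪G₀ upSlot₂, e⟫_ℝ, ⟪G₀ upSlot₃, e⟫_ℝ, -⟪G₀ (basalMirror upSlot₁), e⟫_ℝ, -⟪G₀ (basalMirror upSlot₂), e⟫_ℝ,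
      -⟪G₀ (basalMirror upSlot₃), e⟫_ℝ} : Finset ℝ) id ⟨⟪G₀ upSlot₁, e⟫_ℝ, by simp⟩
  have l1 : ⟪G₀ upSlot₁, e⟫_ℝ ≤ m := hmax _ (by simp)
  have l2 : ⟪G₀ upSlot₂, e⟫_ℝ ≤ m := hmax _ (by simp)
  have l3 : ⟪G₀ upSlot₃, e⟫_ℝ ≤ m := hmax _ (by simp)
  have l4 : -⟪G₀ (basalMirror upSlot₁), e⟫_ℝ ≤ m := hmax _ (by simp)
  have l5 : -⟪G₀ (basalMirror upSlot₂), e⟫_ℝ ≤ m := hmax _ (by simp)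
  have l6 : -⟪G₀ (basalMirror upSlot₃), e⟫_ℝ ≤ m := hmax _ (by simp)
  have hmt : 1 / 2 ≤ m := by
    obtain ⟨u, hu, hu2, hor⟩ := exists_slot_or_capper_inner_ge_half ν hνn hν2
    have l1' := l1; have l2' := l2; have l3' := l3; have l4' := l4; have l5' := l5; have l6' := l6
    rw [hGe] at l1' l2' l3' l4' l5' l6'
    rcases eq_upSlot_of_apply_two hu hu2 with rfl | rfl | rfl <;> rcases hor with h | h <;> linarith
  simp only [Finset.mem_insert, Finset.mem_singleton] at hmem
  have tw : ∀ v w : E3, ⟪upFrame (twinRepFrame L) e v, e⟫_ℝ = -⟪G₀ (basalMirror v), e⟫_ℝ ∧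
      -⟪upFrame (twinRepFrame L) e (basalMirror w), e⟫_ℝ = ⟪G₀ w, e⟫_ℝ := fun v w => twinRep_rises L e v w
  have hGt : 0 ≤ ((upFrame (twinRepFrame L) e).symm e) 2 := upFrame_axis_nonneg _ e
  have hG0 : 0 ≤ (G₀.symm e) 2 := upFrame_axis_nonneg L e
  rcases hmem with h | h | h | h | h | h
  · refine pack L upSlot₁ (Or.inl rfl) hu1 (by rw [h] at hmt; exact hmt) ?_
    exact exists_launch_mean_of_rises G₀ he hG0 hu1 hu2 hu3 (Ne.symm n12) (Ne.symm n13) n23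
      (by rw [h] at hmt; exact hmt) (by linarith) (by linarith)
  · refine pack L upSlot₂ (Or.inl rfl) hu2 (by rw [h] at hmt; exact hmt) ?_
    exact exists_launch_mean_of_rises G₀ he hG0 hu2 hu1 hu3 n12 (Ne.symm n23) n13
      (by rw [h] at hmt; exact hmt) (by linarith) (by linarith)
  · refine pack L upSlot₃ (Or.inl rfl) hu3 (by rw [h] at hmt; exact hmt) ?_
    exact exists_launch_mean_of_rises G₀ he hG0 hu3 hu1 hu2 n13 n23 n12
      (by rw [h] at hmt; exact hmt) (by linarith) (by linarith)
  · refine pack (twinRepFrame L) upSlot₁ (Or.inr rfl) hu1 (by rw [(tw upSlot₁ upSlot₁).1, ← h]; exact hmt) ?_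
    exact exists_launch_mean_of_rises (upFrame (twinRepFrame L) e) he hGt hu1 hu2 hu3 (Ne.symm n12) (Ne.symm n13) n23
      (by rw [(tw upSlot₁ upSlot₁).1, ← h]; exact hmt)
      (by rw [(tw upSlot₁ upSlot₂).2, (tw upSlot₁ upSlot₁).1]; linarith)
      (by rw [(tw upSlot₁ upSlot₃).2, (tw upSlot₁ upSlot₁).1]; linarith)
  · refine pack (twinRepFrame L) upSlot₂ (Or.inr rfl) hu2 (by rw [(tw upSlot₂ upSlot₂).1, ← h]; exact hmt) ?_
    exact exists_launch_mean_of_rises (upFrame (twinRepFrame L) e) he hGt hu2 hu1 hu3 n12 (Ne.symm n23) n13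
      (by rw [(tw upSlot₂ upSlot₂).1, ← h]; exact hmt)
      (by rw [(tw upSlot₂ upSlot₁).2, (tw upSlot₂ upSlot₂).1]; linarith)
      (by rw [(tw upSlot₂ upSlot₃).2, (tw upSlot₂ upSlot₂).1]; linarith)
  · refine pack (twinRepFrame L) upSlot₃ (Or.inr rfl) hu3 (by rw [(tw upSlot₃ upSlot₃).1, ← h]; exact hmt) ?_
    exact exists_launch_mean_of_rises (upFrame (twinRepFrame L) e) he hGt hu3 hu1 hu2 n13 n23 n12
      (by rw [(tw upSlot₃ upSlot₃).1, ← h]; exact hmt)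
      (by rw [(tw upSlot₃ upSlot₁).2, (tw upSlot₃ upSlot₃).1]; linarith)
      (by rw [(tw upSlot₃ upSlot₂).2, (tw upSlot₃ upSlot₃).1]; linarith)

/-! ## Corollary for the adjacent-mean glue -/

/-- **Adjacent-mean strength of the launched family**: with `G = upFrame F e`, slot rise `≥ 1/2` and `½(slot + capper) ≥ √3/4`, the steered family's
step rises (`steerRise`, p705084) on every pair of consecutive bilayers that are NOT BOTH ∇ average to `≥ √3/4` (for any presented word `w`). -/
theorem steerRise_adjMean_ge {G : E3 ≃ₗᵢ[ℝ] E3} {e z v : E3} {w : ℤ → ℤ} (hslot : 1 / 2 ≤ ⟪G v, e⟫_ℝ)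
    (hmean : Real.sqrt 3 / 4 ≤ (⟪G v, e⟫_ℝ + ⟪G (basalMirror (bestCapper (twinFrame G (G e₃)) (G e₃) z)), e⟫_ℝ) / 2)
    {i : ℤ} (hΔ : w i = 1 ∨ w (i + 1) = 1) :
    Real.sqrt 3 / 4 ≤ (steerRise G w e z v i + steerRise G w e z v (i + 1)) / 2 := by
  have h34 : Real.sqrt 3 / 4 ≤ 1 / 2 := by
    have : Real.sqrt 3 ≤ 2 := by
      rw [show (2:ℝ) = Real.sqrt (2 ^ 2) by rw [Real.sqrt_sq (by norm_num)]]
      exact Real.sqrt_le_sqrt (by norm_num)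
    linarith
  unfold steerRise
  by_cases h1 : w i = 1 <;> by_cases h2 : w (i + 1) = 1 <;> simp only [h1, h2, if_true, if_false]
  · linarith
  · linarith
  · linarith
  · exfalso; rcases hΔ with h | h
    · exact h1 h
    · exact h2 h

end Summit.Ventures.Crystal3D.Cruxes.TextureLiminf.TexShadow

end
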